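import Mathlib
import Summits.ValiantsHypothesis.ValiantsHypothesis.Theorems.RigidityForcesSymmetryRankRigidMinimalReprLaplaceFiveSeparatedCaptureTwoTerm
import Summits.ValiantsHypothesis.ValiantsHypothesis.Theorems.RigidityForcesSymmetryRankRigidMinimalReprLaplaceFiveStarT2Relations

/-!
# ValiantsHypothesis / RigidityForcesSymmetry — crux `LaplaceOptimalFive` (stmt-ValiantsHypothesis-24813), symmetric capture:
# **DISTINCT LINES — A NON-PARALLEL PAIR OF PLACEMENT VECTORS KILLS THE OBLIGATION**

Second brick for the profile `(1,1,1)` of `CaptureIneqSym` (memo `pub/val-lit/lmr/NOTE-p4g17-24813-K32-symmetric-capture.md`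
§10 (L4), §11): with one-dimensional triangle spans `ℂu₁, ℂu₂, ℂu₃` a captured obligation reads
`T(p,q,r) = u₁(p,q)a_r + u₂(p,r)b_q + u₃(q,r)c_p`; the EQUAL-lines case is ✓ `finrank_le_three_of_equalLines`.  Here:

* `dot_single3`, `rankOne_of_factor`, `lines_slot1/2/3` — contraction bookkeeping.
* ★ `lines_nonparallel_vanish` — if `T` is symmetric and vanishes at words with a repeated letter and some `2 × 2` minor of
  `(a, b)` is non-zero, then `T = 0`.  Proof: ✓ `twoTerm_binary` makes `u₁, u₂` annihilate `⟨a,b⟩^⊥`; if `c ∈ ⟨a,b⟩` the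
  obligation is annihilated in its first slot by that 3-space and ✓ `LaplaceFiveStar.sqfree_symm3_eq_zero` applies; otherwise
  `a, b, c` are independent, three explicit dual vectors (cofactors of a non-zero `3 × 3` minor) make `u₁, u₂, u₃` multiples of
  `a aᵀ, b bᵀ, c cᵀ`, and ✓ `three_cubes` finishes.
Consequently a non-zero captured obligation on three lines has PAIRWISE PARALLEL placement vectors `a ∥ b ∥ c` — the remaining
(parallel) branch of the `(1,1,1)` count is the successor's step (memo §11).

Honest framing.  A brick; `CaptureIneqSym`, K1 on `K₃ ⊔ K₂` in general, S2′, `LaplaceOptimalFive` (OPEN · CONTESTED 72/120),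
`VP ≠ VNP` are NOT proved.  No definitions, no `sorry`; Mathlib + tree only.
-/

set_option linter.dupNamespace false
set_option autoImplicit false

namespace Summit.ValiantsHypothesis.ValiantsHypothesis.Theorems.RigidityForcesSymmetryRankRigidMinimalRepr

namespace LaplaceFiveSeparatedCapture

open Finset LaplaceFiveSectorSplit

/-! ### Distinct lines: a non-parallel pair of placement vectors kills the obligation -/

/-- Dot product over `Fin 5` with a vector supported on three coordinates (built from `Pi.single`). [folklore] -/
theorem dot_single3 (α₁ α₂ α₃ : ℂ) (r₁ r₂ r₃ : Fin 5) (f : Fin 5 → ℂ) :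
    ∑ r : Fin 5, f r * (α₁ * (Pi.single r₁ (1 : ℂ) : Fin 5 → ℂ) r + α₂ * (Pi.single r₂ (1 : ℂ) : Fin 5 → ℂ) r
      + α₃ * (Pi.single r₃ (1 : ℂ) : Fin 5 → ℂ) r) = α₁ * f r₁ + α₂ * f r₂ + α₃ * f r₃ := by
  simp only [mul_add, Finset.sum_add_distrib, Pi.single_apply, mul_ite, mul_one, mul_zero, Finset.sum_ite_eq',
    Finset.mem_univ, if_true]
  ring

/-- A symmetric matrix of the form `u(q,r) = z_r c_q` with `c r₀ ≠ 0` is `(z r₀ / c r₀)·c cᵀ`. [folklore] -/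
theorem rankOne_of_factor (u : Fin 5 → Fin 5 → ℂ) (hu : ∀ p q, u p q = u q p) (z c : Fin 5 → ℂ)
    (h : ∀ q r, u q r = z r * c q) (r₀ : Fin 5) (hc : c r₀ ≠ 0) (q r : Fin 5) :
    u q r = z r₀ / c r₀ * c q * c r := by
  have h2 : z r * c r₀ = z r₀ * c r := by rw [← h r₀ r, ← h r r₀]; exact hu r₀ r
  rw [h]
  field_simp
  linear_combination c q * h2

/-- Contraction of the third slot of `T(p,q,r) = u₁(p,q)a_r + u₂(p,r)b_q + u₃(q,r)c_p`. [folklore] -/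
theorem lines_slot3 (u₁ u₂ u₃ : Fin 5 → Fin 5 → ℂ) (T : Fin 5 → Fin 5 → Fin 5 → ℂ) (a b c : Fin 5 → ℂ)
    (hT : ∀ p q r, T p q r = u₁ p q * a r + u₂ p r * b q + u₃ q r * c p) (y : Fin 5 → ℂ) (p q : Fin 5) :
    ∑ r, y r * T p q r = u₁ p q * ∑ i, a i * y i + (∑ r, u₂ p r * y r) * b q + (∑ r, u₃ q r * y r) * c p := by
  have : ∀ r, y r * T p q r = u₁ p q * (a r * y r) + u₂ p r * y r * b q + u₃ q r * y r * c p := by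
    intro r; rw [hT]; ring
  rw [Finset.sum_congr rfl fun r _ => this r, Finset.sum_add_distrib, Finset.sum_add_distrib, ← Finset.mul_sum,
    ← Finset.sum_mul, ← Finset.sum_mul]

/-- Contraction of the second slot. [folklore] -/
theorem lines_slot2 (u₁ u₂ u₃ : Fin 5 → Fin 5 → ℂ) (hu₃ : ∀ p q, u₃ p q = u₃ q p) (T : Fin 5 → Fin 5 → Fin 5 → ℂ)
    (a b c : Fin 5 → ℂ) (hT : ∀ p q r, T p q r = u₁ p q * a r + u₂ p r * b q + u₃ q r * c p) (y : Fin 5 → ℂ) (p r : Fin 5) :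
    ∑ q, y q * T p q r = (∑ q, u₁ p q * y q) * a r + u₂ p r * ∑ i, b i * y i + (∑ q, u₃ r q * y q) * c p := by
  have : ∀ q, y q * T p q r = u₁ p q * y q * a r + u₂ p r * (b q * y q) + u₃ r q * y q * c p := by
    intro q; rw [hT, hu₃ q r]; ring
  rw [Finset.sum_congr rfl fun q _ => this q, Finset.sum_add_distrib, Finset.sum_add_distrib, ← Finset.sum_mul,
    ← Finset.mul_sum, ← Finset.sum_mul]

/-- Contraction of the first slot. [folklore] -/
theorem lines_slot1 (u₁ u₂ u₃ : Fin 5 → Fin 5 → ℂ) (hu₁ : ∀ p q, u₁ p q = u₁ q p) (hu₂ : ∀ p q, u₂ p q = u₂ q p)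
    (T : Fin 5 → Fin 5 → Fin 5 → ℂ) (a b c : Fin 5 → ℂ)
    (hT : ∀ p q r, T p q r = u₁ p q * a r + u₂ p r * b q + u₃ q r * c p) (y : Fin 5 → ℂ) (q r : Fin 5) :
    ∑ p, y p * T p q r = (∑ p, u₁ q p * y p) * a r + (∑ p, u₂ r p * y p) * b q + u₃ q r * ∑ i, c i * y i := by
  have : ∀ p, y p * T p q r = u₁ q p * y p * a r + u₂ r p * y p * b q + u₃ q r * (c p * y p) := by
    intro p; rw [hT, hu₁ p q, hu₂ p r]; ring
  rw [Finset.sum_congr rfl fun p _ => this p, Finset.sum_add_distrib, Finset.sum_add_distrib, ← Finset.sum_mul,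
    ← Finset.sum_mul, ← Finset.mul_sum]

set_option maxHeartbeats 1600000 in
/-- ★ NON-PARALLEL KILL.  Let `T(p,q,r) = u₁(p,q)a_r + u₂(p,r)b_q + u₃(q,r)c_p` (u's symmetric) be symmetric and vanish at words
with a repeated letter.  If some `2 × 2` minor of `(a, b)` is non-zero, then `T = 0`.  Proof: ✓ `twoTerm_binary` makes `u₁, u₂`
annihilate `⟨a,b⟩^⊥`; if `c ∈ ⟨a,b⟩` the obligation is annihilated in its first slot by the 3-space `⟨a,b⟩^⊥` and ✓
`LaplaceFiveStar.sqfree_symm3_eq_zero` applies; otherwise `a, b, c` are independent, three explicit dual vectors make `u₁, u₂, u₃`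
multiples of `a aᵀ, b bᵀ, c cᵀ` (`rankOne_of_factor`), and ✓ `three_cubes` finishes. [folklore] -/
theorem lines_nonparallel_vanish (u₁ u₂ u₃ : Fin 5 → Fin 5 → ℂ)
    (hu₁ : ∀ p q, u₁ p q = u₁ q p) (hu₂ : ∀ p q, u₂ p q = u₂ q p) (hu₃ : ∀ p q, u₃ p q = u₃ q p)
    (T : Fin 5 → Fin 5 → Fin 5 → ℂ) (a b c : Fin 5 → ℂ)
    (hT : ∀ p q r, T p q r = u₁ p q * a r + u₂ p r * b q + u₃ q r * c p)
    (h12 : ∀ p q r, T p q r = T q p r) (h23 : ∀ p q r, T p q r = T p r q) (hrep : ∀ p r, T p p r = 0)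
    (r₁ r₂ : Fin 5) (hmin : a r₁ * b r₂ - a r₂ * b r₁ ≠ 0) (p q r : Fin 5) : T p q r = 0 := by
  have h13 : ∀ p q r, T p q r = T r q p := fun p q r => by rw [h12, h23, h12]
  -- the three two-term identities
  have hS12 : ∀ p q r, u₁ p q * a r - u₂ p q * b r = u₁ p r * a q - u₂ p r * b q := by
    intro p q r; have h := h23 p q r; rw [hT, hT, hu₃ r q] at h; linear_combination h
  have hS23 : ∀ p q r, u₂ p q * b r - u₃ p q * c r = u₂ p r * b q - u₃ p r * c q := by
    intro p q r; have h := h12 q r p; rw [hT, hT, hu₁ q r, hu₂ q p, hu₃ r p, hu₂ r p, hu₃ q p] at h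
    linear_combination h
  have hS13 : ∀ p q r, u₁ p q * a r - u₃ p q * c r = u₁ p r * a q - u₃ p r * c q := by
    intro p q r; have h := h13 q p r; rw [hT, hT, hu₁ q p, hu₁ r p, hu₂ r q] at h
    linear_combination h
  have hbin := twoTerm_binary u₁ u₂ a b hS12 r₁ r₂ hmin
  have S1 := lines_slot1 u₁ u₂ u₃ hu₁ hu₂ T a b c hT
  have S2 := lines_slot2 u₁ u₂ u₃ hu₃ T a b c hT
  have S3 := lines_slot3 u₁ u₂ u₃ T a b c hT
  by_cases hdep : ∀ r', a r₁ * (b r₂ * c r' - b r' * c r₂) - b r₁ * (a r₂ * c r' - a r' * c r₂)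
      + c r₁ * (a r₂ * b r' - a r' * b r₂) = 0
  · -- c ∈ ⟨a, b⟩: the 3-space ⟨a,b⟩^⊥ annihilates T in its first slot
    have hcy : ∀ y : Fin 5 → ℂ, ∑ i, a i * y i = 0 → ∑ i, b i * y i = 0 → ∑ i, c i * y i = 0 := by
      intro y hya hyb
      have hc : ∀ r', c r' * (a r₁ * b r₂ - a r₂ * b r₁)
          = a r' * (c r₁ * b r₂ - c r₂ * b r₁) + b r' * (a r₁ * c r₂ - a r₂ * c r₁) := by
        intro r'; linear_combination hdep r'
      have : (∑ i, c i * y i) * (a r₁ * b r₂ - a r₂ * b r₁)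
          = (c r₁ * b r₂ - c r₂ * b r₁) * ∑ i, a i * y i + (a r₁ * c r₂ - a r₂ * c r₁) * ∑ i, b i * y i := by
        rw [Finset.sum_mul, Finset.mul_sum, Finset.mul_sum, ← Finset.sum_add_distrib]
        exact Finset.sum_congr rfl fun i _ => by linear_combination y i * hc i
      rw [hya, hyb, mul_zero, mul_zero, add_zero] at this
      rcases mul_eq_zero.mp this with h | h
      · exact h
      · exact absurd h hmin
    refine LaplaceFiveStar.sqfree_symm3_eq_zero T (fun x y z => h12 x y z) (fun x y z => h23 x y z) hrep a b
      (fun v hva hvb q' r' => ?_) p q r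
    have hva' : ∑ i, a i * v i = 0 := by rw [← hva]; exact Finset.sum_congr rfl fun i _ => mul_comm _ _
    have hvb' : ∑ i, b i * v i = 0 := by rw [← hvb]; exact Finset.sum_congr rfl fun i _ => mul_comm _ _
    rw [S1 v q' r', (hbin v hva' hvb' q').1, (hbin v hva' hvb' r').2, hcy v hva' hvb']; ring
  · -- a, b, c independent: explicit dual vectors
    push Not at hdep
    obtain ⟨r₃, hD⟩ := hdep
    set D := a r₁ * (b r₂ * c r₃ - b r₃ * c r₂) - b r₁ * (a r₂ * c r₃ - a r₃ * c r₂)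
      + c r₁ * (a r₂ * b r₃ - a r₃ * b r₂) with hDdef
    set y₀ : Fin 5 → ℂ := fun i => (a r₂ * b r₃ - a r₃ * b r₂) / D * (Pi.single r₁ (1 : ℂ) : Fin 5 → ℂ) i
      + (a r₃ * b r₁ - a r₁ * b r₃) / D * (Pi.single r₂ (1 : ℂ) : Fin 5 → ℂ) i
      + (a r₁ * b r₂ - a r₂ * b r₁) / D * (Pi.single r₃ (1 : ℂ) : Fin 5 → ℂ) i with hy₀
    set y₁ : Fin 5 → ℂ := fun i => (b r₂ * c r₃ - b r₃ * c r₂) / D * (Pi.single r₁ (1 : ℂ) : Fin 5 → ℂ) i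
      + (b r₃ * c r₁ - b r₁ * c r₃) / D * (Pi.single r₂ (1 : ℂ) : Fin 5 → ℂ) i
      + (b r₁ * c r₂ - b r₂ * c r₁) / D * (Pi.single r₃ (1 : ℂ) : Fin 5 → ℂ) i with hy₁
    set y₂ : Fin 5 → ℂ := fun i => (c r₂ * a r₃ - c r₃ * a r₂) / D * (Pi.single r₁ (1 : ℂ) : Fin 5 → ℂ) i
      + (c r₃ * a r₁ - c r₁ * a r₃) / D * (Pi.single r₂ (1 : ℂ) : Fin 5 → ℂ) i
      + (c r₁ * a r₂ - c r₂ * a r₁) / D * (Pi.single r₃ (1 : ℂ) : Fin 5 → ℂ) i with hy₂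
    have e0a : ∑ i, a i * y₀ i = 0 := by rw [hy₀]; simp only []; rw [dot_single3]; field_simp; ring
    have e0b : ∑ i, b i * y₀ i = 0 := by rw [hy₀]; simp only []; rw [dot_single3]; field_simp; ring
    have e0c : ∑ i, c i * y₀ i = 1 := by rw [hy₀]; simp only []; rw [dot_single3]; field_simp; rw [hDdef]; ring
    have e1b : ∑ i, b i * y₁ i = 0 := by rw [hy₁]; simp only []; rw [dot_single3]; field_simp; ring
    have e1c : ∑ i, c i * y₁ i = 0 := by rw [hy₁]; simp only []; rw [dot_single3]; field_simp; ring
    have e1a : ∑ i, a i * y₁ i = 1 := by rw [hy₁]; simp only []; rw [dot_single3]; field_simp; rw [hDdef]; ring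
    have e2a : ∑ i, a i * y₂ i = 0 := by rw [hy₂]; simp only []; rw [dot_single3]; field_simp; ring
    have e2c : ∑ i, c i * y₂ i = 0 := by rw [hy₂]; simp only []; rw [dot_single3]; field_simp; ring
    have e2b : ∑ i, b i * y₂ i = 1 := by rw [hy₂]; simp only []; rw [dot_single3]; field_simp; rw [hDdef]; ring
    -- non-zero vectors and 2×2 minors of (b,c) and (a,c)
    have ha0 : ∃ s, a s ≠ 0 := by
      by_contra h; push Not at h; apply hD; rw [hDdef, h r₁, h r₂, h r₃]; ring
    have hb0 : ∃ s, b s ≠ 0 := by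
      by_contra h; push Not at h; apply hD; rw [hDdef, h r₁, h r₂, h r₃]; ring
    have hc0 : ∃ s, c s ≠ 0 := by
      by_contra h; push Not at h; apply hD; rw [hDdef, h r₁, h r₂, h r₃]; ring
    have hbc : ∃ s₁ s₂, b s₁ * c s₂ - b s₂ * c s₁ ≠ 0 := by
      by_contra hall; push Not at hall; apply hD; rw [hDdef]
      linear_combination a r₁ * hall r₂ r₃ - a r₂ * hall r₁ r₃ + a r₃ * hall r₁ r₂
    have hac : ∃ s₁ s₂, a s₁ * c s₂ - a s₂ * c s₁ ≠ 0 := by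
      by_contra hall; push Not at hall; apply hD; rw [hDdef]
      linear_combination - b r₁ * hall r₂ r₃ + b r₂ * hall r₁ r₃ - b r₃ * hall r₁ r₂
    obtain ⟨sa, hsa⟩ := ha0
    obtain ⟨sb, hsb⟩ := hb0
    obtain ⟨sc, hsc⟩ := hc0
    obtain ⟨s₁, s₂, hmin23⟩ := hbc
    obtain ⟨t₁, t₂, hmin13⟩ := hac
    have hbin23 := twoTerm_binary u₂ u₃ b c hS23 s₁ s₂ hmin23
    have hbin13 := twoTerm_binary u₁ u₃ a c hS13 t₁ t₂ hmin13
    -- u₃ = κ₃ c cᵀ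
    have hu3 : ∀ q' r', u₃ q' r' = (∑ i, u₃ r' i * y₀ i) * c q' := by
      intro q' r'
      have l1 : ∑ p', y₀ p' * T p' q' r' = u₃ q' r' := by
        rw [S1 y₀ q' r', (hbin y₀ e0a e0b q').1, (hbin y₀ e0a e0b r').2, e0c]; ring
      have l2 : ∑ p', y₀ p' * T p' q' r' = ∑ p', y₀ p' * T q' r' p' := Finset.sum_congr rfl fun p' _ => by rw [h12 p' q' r', h23 q' p' r']
      have l3 : ∑ p', y₀ p' * T q' r' p' = (∑ i, u₃ r' i * y₀ i) * c q' := by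
        rw [S3 y₀ q' r', e0a, (hbin y₀ e0a e0b q').2]; ring
      rw [← l1, l2, l3]
    have hu3r := rankOne_of_factor u₃ hu₃ (fun i => ∑ j, u₃ i j * y₀ j) c hu3 sc hsc
    -- u₁ = κ₁ a aᵀ
    have hu1 : ∀ q' r', u₁ q' r' = (∑ i, u₁ r' i * y₁ i) * a q' := by
      intro q' r'
      have l1 : ∑ p', y₁ p' * T q' r' p' = u₁ q' r' := by
        rw [S3 y₁ q' r', e1a, (hbin23 y₁ e1b e1c q').1, (hbin23 y₁ e1b e1c r').2]; ring
      have l2 : ∑ p', y₁ p' * T q' r' p' = ∑ p', y₁ p' * T p' r' q' := Finset.sum_congr rfl fun p' _ => by rw [h13, h23]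
      have l3 : ∑ p', y₁ p' * T p' r' q' = (∑ i, u₁ r' i * y₁ i) * a q' := by
        rw [S1 y₁ r' q', (hbin23 y₁ e1b e1c q').1, e1c]; ring
      rw [← l1, l2, l3]
    have hu1r := rankOne_of_factor u₁ hu₁ (fun i => ∑ j, u₁ i j * y₁ j) a hu1 sa hsa
    -- u₂ = κ₂ b bᵀ
    have hu2 : ∀ q' r', u₂ q' r' = (∑ i, u₂ r' i * y₂ i) * b q' := by
      intro q' r'
      have l1 : ∑ p', y₂ p' * T q' p' r' = u₂ q' r' := by
        rw [S2 y₂ q' r', (hbin13 y₂ e2a e2c q').1, (hbin13 y₂ e2a e2c r').2, e2b]; ring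
      have l2 : ∑ p', y₂ p' * T q' p' r' = ∑ p', y₂ p' * T p' q' r' := Finset.sum_congr rfl fun p' _ => by rw [h12]
      have l3 : ∑ p', y₂ p' * T p' q' r' = (∑ i, u₂ r' i * y₂ i) * b q' := by
        rw [S1 y₂ q' r', (hbin13 y₂ e2a e2c q').1, e2c]; ring
      rw [← l1, l2, l3]
    have hu2r := rankOne_of_factor u₂ hu₂ (fun i => ∑ j, u₂ i j * y₂ j) b hu2 sb hsb
    -- three cubes
    set κ₁ := (∑ j, u₁ sa j * y₁ j) / a sa with hκ₁
    set κ₂ := (∑ j, u₂ sb j * y₂ j) / b sb with hκ₂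
    set κ₃ := (∑ j, u₃ sc j * y₀ j) / c sc with hκ₃
    have hcube : ∀ p' r', κ₁ * a p' ^ 2 * a r' + κ₂ * b p' ^ 2 * b r' + κ₃ * c p' ^ 2 * c r' = 0 := by
      intro p' r'
      have h0 := hrep p' r'
      rw [hT, hu1r p' p', hu2r p' r', hu3r p' r'] at h0
      linear_combination h0
    have h3 := three_cubes κ₁ κ₂ κ₃ a b c hcube r₁ r₂ r₃ hD
    have z1 : κ₁ * a p = 0 := by
      rcases mul_eq_zero.mp (h3 p).1 with h | h
      · rw [h, zero_mul]
      · rw [pow_eq_zero_iff two_ne_zero |>.mp h, mul_zero]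
    have z2 : κ₂ * b p = 0 := by
      rcases mul_eq_zero.mp (h3 p).2.1 with h | h
      · rw [h, zero_mul]
      · rw [pow_eq_zero_iff two_ne_zero |>.mp h, mul_zero]
    have z3 : κ₃ * c q = 0 := by
      rcases mul_eq_zero.mp (h3 q).2.2 with h | h
      · rw [h, zero_mul]
      · rw [pow_eq_zero_iff two_ne_zero |>.mp h, mul_zero]
    rw [hT, hu1r p q, hu2r p r, hu3r q r]
    linear_combination a q * a r * z1 + b r * b q * z2 + c r * c p * z3

end LaplaceFiveSeparatedCapture

end Summit.ValiantsHypothesis.ValiantsHypothesis.Theorems.RigidityForcesSymmetryRankRigidMinimalRepr
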